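import Literature.AlgebraicGeometry.AbelianSchemes.IsogenyOfGenericIsogeny
import Literature.AlgebraicGeometry.AbelianSchemes.AbelianSchemeOverLevelBaseChange
import Mathlib.AlgebraicGeometry.Morphisms.FlatRank
import HarnessLib

/-!
# The kernel of a generic isogeny over a Dedekind domain has CONSTANT rank `deg φ_K`, and every fibre `φ_t` has degree `deg φ_K`
# ([GortzWedhorn2023] Cor. 27.177 (1); [BoschLutkebohmertRaynaud1990] §7.3 Prop. 6 (p. 180))

Topic `Literature/AlgebraicGeometry/AbelianSchemes`, namespace `Literature.AlgebraicGeometry.AbelianSchemes.AbelianSchemeOver`.  THEOREMS ONLY (no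
definition, no named fact, no instance, no notation, no `sorry`).  Sequel (ED. 2 as a SIBLING) of ★ `AbelianSchemes/IsogenyOfGenericIsogeny` ((o-c2f): a
homomorphism `φ : A → B` of abelian schemes over a Dedekind domain `R` with fraction field `K` whose generic fibre is an isogeny is an isogeny on every
fibre, finite, with finite flat kernel `Ker φ = Spec R ×_{e,B,φ} A → Spec R`).  THIS FILE = the RANK clause **(o-c2f′)** of the P6c desk (F0P6c-plan (g0),
2026-09-01): the rank of the finite locally free `Ker φ → Spec R` is CONSTANT on the connected `Spec R`, equal to `deg φ_K := kerRank φ_K` (Mathlib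
`Scheme.Hom.isLocallyConstant_finrank` for finite flat locally finitely presented morphisms, `Scheme.Hom.finrank_pullback_fst`, ★
`finrank_left_fst_eq_kerRank_fibreHom`), and consequently `deg φ_t = deg φ_K` at EVERY field point `t` — in particular `rank (Ker φ)_κ = rank (Ker φ)_K`
for the special fibre of a DVR, the count DICT (c2) `red_translΩ` and (b4′) `canonicalLine` use.  Generic capital `--supports stmt-HodgeConjecture-24832`.
HONEST LABEL: HC_CM is proved only modulo the cell's 2 remaining named inputs (hLiu418 24832, h413 24833) until rung 0 closes; this file pays no letter.

* `locallyOfFinitePresentation_fst_unit`, `isLocallyConstant_finrank_fst_unit` — plumbing for `Ker φ → Spec R`;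
* **`finrank_fst_unit_eq_kerRank_genericFibre`** — `finrank (Ker φ → Spec R) s = kerRank φ_K` for every `s ∈ Spec R`;
* **`kerRank_fibreHom_eq_kerRank_genericFibre`** — `kerRank φ_t = kerRank φ_K` for every field point `t : Spec Ω → Spec R`.

## References
* [GortzWedhorn2023] U. Görtz, T. Wedhorn, *Algebraic Geometry II* (2023), Def. 27.176, Cor. 27.177 (1) («`Ker(f)` is a finite locally free group scheme over
  `S`»; its rank is locally constant).
* [BoschLutkebohmertRaynaud1990] S. Bosch, W. Lütkebohmert, M. Raynaud, *Néron Models* (1990), §7.3 Prop. 6 (p. 180) (`deg f` of an isogeny of Néron models).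
* [StacksProject] The Stacks Project, Tag 02KA (rank of a finite locally free morphism is locally constant).
-/

set_option autoImplicit false

noncomputable section

universe u

open CategoryTheory CategoryTheory.Limits AlgebraicGeometry MonoidalCategory CartesianMonoidalCategory
open scoped MonObj CategoryTheory.Obj
open Literature.NumberTheory.EllipticCurves (genericFibre specGenericPoint)
open Literature.AlgebraicGeometry.Motives (AbelianVariety)

namespace Literature.AlgebraicGeometry.AbelianSchemes

namespace AbelianSchemeOver

variable {R : Type u} [CommRing R] [IsDedekindDomain R] (K : Type u) [Field K] [Algebra R K] [IsFractionRing R K]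
  {A B : AbelianSchemeOver (Spec (CommRingCat.of R))} (φ : A.X ⟶ B.X) [IsMonHom φ]

omit [IsDedekindDomain R] [IsMonHom φ] in
/-- `Ker φ → Spec R` is locally of finite presentation (base change of `φ`, which is, ★ `locallyOfFinitePresentation_hom_left`).
[cite: GortzWedhorn2023, Cor. 27.177 (1)] -/
theorem locallyOfFinitePresentation_fst_unit :
    LocallyOfFinitePresentation (pullback.fst (η[B.X] : 𝟙_ (Over (Spec (CommRingCat.of R))) ⟶ B.X).left φ.left) := by
  haveI := locallyOfFinitePresentation_hom_left φ
  infer_instance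

/-- **The rank of `Ker φ → Spec R` is locally constant** (finite, flat, locally of finite presentation: Mathlib
`Scheme.Hom.isLocallyConstant_finrank`). [cite: StacksProject, Tag 02KA] [cite: GortzWedhorn2023, Cor. 27.177 (1)] -/
theorem isLocallyConstant_finrank_fst_unit (hφ : AbelianVariety.IsIsogeny (fibreHom φ (specGenericPoint R K))) :
    IsLocallyConstant (Scheme.Hom.finrank (pullback.fst (η[B.X] : 𝟙_ (Over (Spec (CommRingCat.of R))) ⟶ B.X).left φ.left)) := by
  haveI := isFinite_fst_unit_of_isIsogeny_genericFibre K φ hφ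
  haveI := flat_fst_unit_of_isIsogeny_genericFibre K φ hφ
  haveI := locallyOfFinitePresentation_fst_unit (R := R) φ
  exact Scheme.Hom.isLocallyConstant_finrank _

/-- **`rank (Ker φ → Spec R) = deg φ_K` at EVERY point of `Spec R`** for a generic isogeny `φ` over a Dedekind domain: the rank is locally constant on
the connected `Spec R`, and at the generic point it is the rank of `φ` at the unit of `B_K`, i.e. `kerRank φ_K` (★ `finrank_left_fst_eq_kerRank_fibreHom`).
[cite: GortzWedhorn2023, Cor. 27.177 (1)] [cite: BoschLutkebohmertRaynaud1990, §7.3 Prop. 6 (p. 180)] -/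
theorem finrank_fst_unit_eq_kerRank_genericFibre (hφ : AbelianVariety.IsIsogeny (fibreHom φ (specGenericPoint R K)))
    (s : ↥(Spec (CommRingCat.of R))) :
    Scheme.Hom.finrank (pullback.fst (η[B.X] : 𝟙_ (Over (Spec (CommRingCat.of R))) ⟶ B.X).left φ.left) s =
      AbelianVariety.Hom.kerRank (fibreHom φ (specGenericPoint R K)) := by
  have hiso : ∀ ⦃Ω : Type u⦄ [Field Ω] [IsAlgClosed Ω] (t : Spec (.of Ω) ⟶ Spec (.of R)), AbelianVariety.IsIsogeny (fibreHom φ t) :=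
    fun _ _ _ t => isIsogeny_fibreHom_of_isIsogeny_genericFibre K φ hφ t
  haveI := isFinite_left_of_isIsogeny_fibreHom φ hiso
  haveI := flat_left_of_isIsogeny_fibreHom φ hiso
  haveI : ConnectedSpace ↥((𝟙_ (Over (Spec (CommRingCat.of R)))).left) :=
    inferInstanceAs (ConnectedSpace ↥(Spec (CommRingCat.of R)))
  -- the generic point `ξ` and the unit point `y′` of `B_K` over it
  let x₀ : ↥(Spec (CommRingCat.of K)) := IsLocalRing.closedPoint K
  let ξ : ↥(Spec (CommRingCat.of R)) := specGenericPoint R K x₀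
  have hconst := (isLocallyConstant_finrank_fst_unit K φ hφ).apply_eq_of_preconnectedSpace s ξ
  rw [hconst, Scheme.Hom.finrank_pullback_fst]
  -- `η (ξ) = pr₁ (η_K (x₀))` and the ★ rank formula under the generic fibre
  have hy : (pullback.fst B.X.hom (specGenericPoint R K)).base
        ((η[(B.baseChange (specGenericPoint R K)).X] : 𝟙_ _ ⟶ _).left.base x₀) =
      (η[B.X] : 𝟙_ _ ⟶ B.X).left.base ((specGenericPoint R K).base x₀) :=
    congrArg (fun f => f.base x₀) (one_baseChange_left_comp_fst B (specGenericPoint R K))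
  have h1 := finrank_left_fst_eq_kerRank_fibreHom φ hiso (specGenericPoint R K) hφ
    (((η[(B.baseChange (specGenericPoint R K)).X] : 𝟙_ _ ⟶ _).left).base x₀)
  rw [← h1]
  exact congrArg (Scheme.Hom.finrank φ.left) hy.symm

/-- **`deg φ_t = deg φ_K` at every field point** `t : Spec Ω → Spec R` (e.g. the special fibre of a DVR): both are the rank of `Ker φ → Spec R` at the
image point. [cite: GortzWedhorn2023, Cor. 27.177 (1)] [cite: BoschLutkebohmertRaynaud1990, §7.3 Prop. 6 (p. 180)] -/
theorem kerRank_fibreHom_eq_kerRank_genericFibre (hφ : AbelianVariety.IsIsogeny (fibreHom φ (specGenericPoint R K))) {Ω : Type u} [Field Ω]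
    (t : Spec (CommRingCat.of Ω) ⟶ Spec (CommRingCat.of R)) :
    AbelianVariety.Hom.kerRank (fibreHom φ t) = AbelianVariety.Hom.kerRank (fibreHom φ (specGenericPoint R K)) := by
  have hiso : ∀ ⦃Ω : Type u⦄ [Field Ω] [IsAlgClosed Ω] (t : Spec (.of Ω) ⟶ Spec (.of R)), AbelianVariety.IsIsogeny (fibreHom φ t) :=
    fun _ _ _ t => isIsogeny_fibreHom_of_isIsogeny_genericFibre K φ hφ t
  haveI := isFinite_left_of_isIsogeny_fibreHom φ hiso
  haveI := flat_left_of_isIsogeny_fibreHom φ hiso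
  let x₀ : ↥(Spec (CommRingCat.of Ω)) := IsLocalRing.closedPoint Ω
  have ht := isIsogeny_fibreHom_of_isIsogeny_genericFibre K φ hφ t
  have h1 := finrank_left_fst_eq_kerRank_fibreHom φ hiso t ht (((η[(B.baseChange t).X] : 𝟙_ _ ⟶ _).left).base x₀)
  have hy : (pullback.fst B.X.hom t).base (((η[(B.baseChange t).X] : 𝟙_ _ ⟶ _).left).base x₀) =
      (η[B.X] : 𝟙_ _ ⟶ B.X).left.base (t.base x₀) :=
    congrArg (fun f => f.base x₀) (one_baseChange_left_comp_fst B t)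
  have h2 := finrank_fst_unit_eq_kerRank_genericFibre K φ hφ (t.base x₀)
  rw [Scheme.Hom.finrank_pullback_fst] at h2
  rw [← h1, ← h2]
  exact congrArg (Scheme.Hom.finrank φ.left) hy

end AbelianSchemeOver

end Literature.AlgebraicGeometry.AbelianSchemes

end
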